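import Literature.Algebra.Lie.SpecialUnitaryKilling
import Literature.MathematicalPhysics.QuantumLattice.RepLieAlgebraUnitary
import Summits.QuantumFields.YangMills.Theorems.BalabanLadderUVNonSUNRecLieRatio
import HarnessLib

/-!
# Route `BalabanLadder`, residual leg `UVOtherGroups` (stmt-QuantumFields-19356): the group datum of the
# non-`SU(N)` record `UVNonSUNRec` AT `(SU(N), fundamental)` IS the `SU(N)` number — **`LieRatio (fundamentalLatticeRep N) (2N)`**

Helper for the residual leg `UVOtherGroups` (stmt-QuantumFields-19356) of route `route-QuantumFields-BalabanLadder`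
and its R85 successors (`UVApexSUN` ∕ `UVSeamWitnessSUN` = the `SU(N)` part, `UVNonSUNRec` = the non-`SU(N)` record;
owner ★ym-beyond-p2, batch of record R85 rev 3i).  The record's ONE group datum is the Killing∕trace ratio
`LieRatio r λ` of `𝔨 = repLieSubalgebra r` (D-0016 file `BalabanLadderUVNonSUNRecDefs.lean`, p479492), which enters the
two-loop asymptotic-scaling unit `uRecOf λ β` of the line; its companion `BalabanLadderUVNonSUNRecLieRatio.lean` (p481786)
proves `λ(G, r) > 0` EXISTS and is unique for every compact simple `G` and faithful unitary `r`, and the Defs docstring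
ASSERTS the value «`2N` for the fundamental of `SU(N)`» without proof.

THIS FILE computes that value in the kernel: for `N ≥ 2`,
**`UVNonSUNRec.LieRatio (fundamentalLatticeRep N) (2 * N)`** (`lieRatio_fundamental`), hence by uniqueness
`LieRatio (fundamentalLatticeRep N) λ ↔ λ = 2N` (`lieRatio_fundamental_iff`); and the datum is EMPTY for `N ≤ 1`
(`not_lieRatio_fundamental_of_le_one`: `𝔰𝔲(1) = 𝔰𝔲(0) = 0`), so `(∃ λ, LieRatio (fundamentalLatticeRep N) λ) ↔ 2 ≤ N`
(`exists_lieRatio_fundamental_iff`) — the record's «`2 ≤ N`» guard is exactly the inhabitation condition of its own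
group datum at `SU(N)`.

WHY (bookkeeping value, D-0061 flavour).  At the R85 edit the residual `UVOtherGroups` splits into the `SU(N)` pieces
(apex currency: Track A's texts with `2 ↦ N`, whose constants are the `SU(N)` numbers — `C_A/T_F = 2N` in the
two-loop unit) and the non-`SU(N)` record keyed by the generic datum `LieRatio r λ`.  This file certifies that the
generic datum, instantiated at the `SU(N)` class representative `(SU(N), fundamental)`, returns the `SU(N)` number:
the two halves of the split use ONE normalisation (no hidden factor between `uRecOf (2N)` and the `SU(N)` unit).

Route of proof: `𝔨 = repLieSubalgebra (fundamentalLatticeRep N)` has the carrier of `𝔰𝔲(N)` (tree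
`repLieAlgebra_fundamental`, Hall Prop. 3.24), so it IS the tree's `CompactKillingForm.su (Fin N)` as a real Lie
subalgebra of `M_N(ℂ)` (`repLieSubalgebra_fundamental_eq_su`); Killing forms are transported along `LieEquiv.ofEq`
(Mathlib `LieAlgebra.killingForm_of_equiv_apply`); and **`κ_{𝔰𝔲(n)}(X, Y) = 2n·Re Tr(XY)`** is the tree's
`Literature.Algebra.Lie.SpecialUnitaryKilling.killingForm_su` (Sepanski, *Compact Lie Groups*, Exercise 6.19 (1), via
the complexification `𝔰𝔲(n)ᶜ = 𝔰𝔩(n, ℂ)` and Humphreys §6 Ex. 7).  The witness for «trace form not identically zero»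
is any `X ≠ 0` of the `(N² − 1)`-dimensional `𝔨` (`Re Tr X² = −‖X‖²_HS < 0`, tree `re_trace_mul_self_neg`).

HONEST FRAMING: classical Lie algebra (the value of one constant); a consistency certificate between the two halves
of a RESIDUAL leg of a CONDITIONAL chain.  Nothing of Bałaban's programme, no estimate, no continuum limit, no mass gap
is asserted; the three XL stubs of `UVNonSUNRec` and the `SU(N)` pieces are untouched; not a gap, not Clay.
No named facts; no `sorry`; axioms standard.  Seat ym-osasm-p2 g7 (R136 (iii)), `--supports stmt-QuantumFields-19356`.

References: M. R. Sepanski, *Compact Lie Groups*, GTM 235 (2007), §6.2.2 Thm. 6.16, Exercise 6.19 (1);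
B. C. Hall, GTM 222 (2015), Prop. 3.24, (3.17); J. E. Humphreys, GTM 9 (1972), §6 Ex. 7;
T. Bałaban, Commun. Math. Phys. 109 (1987) 249, p. 289 (the group enters the unit through `C_A/T_r`).
-/

set_option autoImplicit false

noncomputable section

open scoped Matrix
open Literature.MathematicalPhysics.QuantumFieldTheory
open Literature.MathematicalPhysics.QuantumLattice
open Literature.Algebra.Lie.CompactKillingForm (su mem_su_iff)
open Literature.Algebra.Lie.SpecialUnitaryKilling (killingForm_su)

namespace Summit.QuantumFields.YangMills.Theorems.UVNonSUNRec

/-! ## §1 `𝔨(SU(N), fundamental) = 𝔰𝔲(N)` as a real Lie subalgebra of `M_N(ℂ)` -/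

/-- The concrete matrix Lie algebra of the fundamental representation of `SU(N)` IS the tree's `𝔰𝔲(N)`
(`CompactKillingForm.su (Fin N)`: traceless skew-Hermitian matrices, commutator bracket) — same carrier by
`repLieAlgebra_fundamental` (Hall, Prop. 3.24: the Lie algebra of `SU(n)` is `{X : X* = −X, tr X = 0}`).
[cite: Hall2015, Proposition 3.24] -/
theorem repLieSubalgebra_fundamental_eq_su (N : ℕ) :
    repLieSubalgebra (fundamentalLatticeRep N) = su (Fin N) :=
  SetLike.ext fun X =>
    ((mem_repLieSubalgebra_iff _).trans (SetLike.ext_iff.1 (repLieAlgebra_fundamental N) X)).trans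
      ((mem_suAlgebra_iff X).trans mem_su_iff.symm)

/- Note on types: the carrier of `repLieSubalgebra (fundamentalLatticeRep N)` is `Matrix (Fin (fundamentalLatticeRep N).N)
(Fin (fundamentalLatticeRep N).N) ℂ`, with `(fundamentalLatticeRep N).N = N` by `rfl` (`fundamentalLatticeRep_N`) but not
reducibly; below the matrix coercions are therefore written at that carrier type — exactly the shape
`(X : Matrix (Fin r.N) (Fin r.N) ℂ)` of the definition `LieRatio r λ` at `r = fundamentalLatticeRep N`. -/

/-! ## §2 The Killing form of `𝔨(SU(N), fundamental)`: `κ(X, Y) = 2N·Re Tr(XY)` -/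

/-- **`κ(X, Y) = 2N·Re Tr(XY)` on `𝔨 = repLieSubalgebra (fundamentalLatticeRep N)`** — the Killing form of `𝔰𝔲(N)`
(Sepanski Exercise 6.19 (1), tree `SpecialUnitaryKilling.killingForm_su`) transported along the identity
isomorphism `LieEquiv.ofEq` of §1 (Mathlib `LieAlgebra.killingForm_of_equiv_apply`).
[cite: Sepanski2007, §6.2.2 Exercise 6.19 (1)] -/
theorem killingForm_fundamental (N : ℕ) (X Y : repLieSubalgebra (fundamentalLatticeRep N)) :
    killingForm ℝ (repLieSubalgebra (fundamentalLatticeRep N)) X Y =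
      2 * N * ((X : Matrix (Fin (fundamentalLatticeRep N).N) (Fin (fundamentalLatticeRep N).N) ℂ) *
        (Y : Matrix (Fin (fundamentalLatticeRep N).N) (Fin (fundamentalLatticeRep N).N) ℂ)).trace.re := by
  -- the identity isomorphism `𝔨 ≃ₗ⁅ℝ⁆ 𝔰𝔲(N)` (same carrier, §1), read in `M_N(ℂ)`; the commutator Lie ring of `M_N(ℂ)` is
  -- Mathlib's non-instance `LieRing.ofAssociativeRing`, supplied explicitly (no instance attribute in this file)
  let e := @LieEquiv.ofEq ℝ (Matrix (Fin N) (Fin N) ℂ) _ LieRing.ofAssociativeRing _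
    (repLieSubalgebra (fundamentalLatticeRep N)) (su (Fin N)) (congrArg SetLike.coe (repLieSubalgebra_fundamental_eq_su N))
  have h1 := LieAlgebra.killingForm_of_equiv_apply e X Y
  have h2 := killingForm_su (e X) (e Y)
  rw [Fintype.card_fin] at h2
  exact h1.symm.trans h2

/-- Diagonal form: `κ(X, X) = 2N·Re Tr(X²)` on `𝔨(SU(N), fundamental)` — the third conjunct of `LieRatio` with `λ = 2N`.
[cite: Sepanski2007, §6.2.2 Exercise 6.19 (1)] -/
theorem killingForm_fundamental_apply_self (N : ℕ) (X : repLieSubalgebra (fundamentalLatticeRep N)) :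
    killingForm ℝ (repLieSubalgebra (fundamentalLatticeRep N)) X X =
      (2 * N : ℝ) * ((X : Matrix (Fin (fundamentalLatticeRep N).N) (Fin (fundamentalLatticeRep N).N) ℂ) *
        (X : Matrix (Fin (fundamentalLatticeRep N).N) (Fin (fundamentalLatticeRep N).N) ℂ)).trace.re :=
  killingForm_fundamental N X X

/-! ## §3 Inhabitation of the trace form: `𝔨 ≠ 0` iff `N ≥ 2` -/

/-- For `N ≥ 2` the Lie algebra `𝔨(SU(N), fundamental)` (real dimension `N² − 1 ≥ 3`, tree
`finrank_repLieAlgebra_fundamental`) has a non-zero element. [cite: BrockerTomDieck1985, I (2.18)] -/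
theorem exists_ne_zero_fundamental {N : ℕ} (hN : 2 ≤ N) :
    ∃ X : repLieSubalgebra (fundamentalLatticeRep N), X ≠ 0 := by
  have h4 : 4 ≤ N ^ 2 := by
    calc (4 : ℕ) = 2 ^ 2 := by norm_num
      _ ≤ N ^ 2 := Nat.pow_le_pow_left hN 2
  have hpos : 0 < Module.finrank ℝ (repLieAlgebra (fundamentalLatticeRep N)) := by
    rw [finrank_repLieAlgebra_fundamental]
    exact Nat.sub_pos_of_lt (lt_of_lt_of_le (by norm_num) h4)
  obtain ⟨x, hx⟩ := Module.finrank_pos_iff_exists_ne_zero.1 hpos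
  refine ⟨⟨x.1, x.2⟩, fun h => hx (Subtype.ext ?_)⟩
  exact congrArg Subtype.val h

/-- For `N ≥ 2` the trace form `X ↦ Re Tr X²` is not identically zero on `𝔨(SU(N), fundamental)`: at any `X ≠ 0` it is
`−‖X‖²_HS < 0` (tree `re_trace_mul_self_neg`). [cite: Hall2015, Exercise 7.3] -/
theorem exists_re_trace_mul_self_ne_zero_fundamental {N : ℕ} (hN : 2 ≤ N) :
    ∃ X : repLieSubalgebra (fundamentalLatticeRep N),
      ((X : Matrix (Fin (fundamentalLatticeRep N).N) (Fin (fundamentalLatticeRep N).N) ℂ) *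
        (X : Matrix (Fin (fundamentalLatticeRep N).N) (Fin (fundamentalLatticeRep N).N) ℂ)).trace.re ≠ 0 := by
  obtain ⟨X, hX⟩ := exists_ne_zero_fundamental hN
  exact ⟨X, ne_of_lt (re_trace_mul_self_neg (fundamentalLatticeRep N) hX)⟩

/-- For `N ≤ 1` the Lie algebra `𝔨(SU(N), fundamental)` is ZERO (`dim = N² − 1 = 0`): every element vanishes.
[cite: BrockerTomDieck1985, I (2.18)] -/
theorem coe_eq_zero_fundamental_of_le_one {N : ℕ} (hN : N ≤ 1) (X : repLieSubalgebra (fundamentalLatticeRep N)) :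
    (X : Matrix (Fin (fundamentalLatticeRep N).N) (Fin (fundamentalLatticeRep N).N) ℂ) = 0 := by
  have h0 : Module.finrank ℝ (repLieAlgebra (fundamentalLatticeRep N)) = 0 := by
    rw [finrank_repLieAlgebra_fundamental]
    interval_cases N <;> norm_num
  haveI : Subsingleton (repLieAlgebra (fundamentalLatticeRep N)) := Module.finrank_zero_iff.1 h0
  have hx : (⟨X.1, X.2⟩ : repLieAlgebra (fundamentalLatticeRep N)) = 0 := Subsingleton.elim _ _
  exact congrArg Subtype.val hx

/-! ## §4 THE VALUE: `LieRatio (fundamentalLatticeRep N) (2N)` for `N ≥ 2`, and nothing for `N ≤ 1` -/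

/-- **THE GROUP DATUM OF THE RECORD AT `(SU(N), fundamental)` IS `2N`**: for `N ≥ 2`,
`UVNonSUNRec.LieRatio (fundamentalLatticeRep N) (2 * N)` — `2N > 0`, the trace form is not identically zero on
`𝔰𝔲(N)`, and `κ(X, X) = 2N·Re Tr X²` (the Defs docstring's «`2N` for the fundamental of `SU(N)`», `C_A/T_F`, now
kernel-checked). [cite: Sepanski2007, §6.2.2 Exercise 6.19 (1)] -/
theorem lieRatio_fundamental {N : ℕ} (hN : 2 ≤ N) : LieRatio (fundamentalLatticeRep N) (2 * N) := by
  refine ⟨?_, exists_re_trace_mul_self_ne_zero_fundamental hN, fun X => ?_⟩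
  · have : (0 : ℝ) < N := Nat.cast_pos.2 (lt_of_lt_of_le (by norm_num) hN)
    positivity
  · exact killingForm_fundamental_apply_self N X

/-- Uniqueness form: for `N ≥ 2`, `LieRatio (fundamentalLatticeRep N) λ ↔ λ = 2N` (tree `LieRatio.unique`). [folklore] -/
theorem lieRatio_fundamental_iff {N : ℕ} (hN : 2 ≤ N) (lam : ℝ) :
    LieRatio (fundamentalLatticeRep N) lam ↔ lam = 2 * N :=
  ⟨fun h => h.unique (lieRatio_fundamental hN), fun h => h ▸ lieRatio_fundamental hN⟩

/-- Any `λ` with `LieRatio (fundamentalLatticeRep N) λ` equals `2N` (`N ≥ 2`). [folklore] -/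
theorem eq_two_mul_of_lieRatio_fundamental {N : ℕ} (hN : 2 ≤ N) {lam : ℝ}
    (h : LieRatio (fundamentalLatticeRep N) lam) : lam = 2 * N :=
  (lieRatio_fundamental_iff hN lam).1 h

/-- SHARPNESS of the guard `2 ≤ N`: for `N ≤ 1` the datum is EMPTY — `𝔰𝔲(1) = 𝔰𝔲(0) = 0`, so the second conjunct
of `LieRatio` («trace form not identically zero») fails for every `λ`. [folklore] -/
theorem not_lieRatio_fundamental_of_le_one {N : ℕ} (hN : N ≤ 1) (lam : ℝ) :
    ¬ LieRatio (fundamentalLatticeRep N) lam := by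
  rintro ⟨-, ⟨X, hX⟩, -⟩
  apply hX
  rw [coe_eq_zero_fundamental_of_le_one hN X, Matrix.mul_zero, Matrix.trace_zero, Complex.zero_re]

/-- **Inhabitation of the record's group datum at `SU(N)` ⇔ `2 ≤ N`** — the record's `N`-guard is exactly the
condition under which its own datum exists at the `SU(N)` class representative. [folklore] -/
theorem exists_lieRatio_fundamental_iff (N : ℕ) :
    (∃ lam : ℝ, LieRatio (fundamentalLatticeRep N) lam) ↔ 2 ≤ N := by
  refine ⟨fun ⟨lam, h⟩ => ?_, fun hN => ⟨2 * N, lieRatio_fundamental hN⟩⟩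
  by_contra hlt
  exact not_lieRatio_fundamental_of_le_one (by omega) lam h

/-! ## §5 The spine's own class `SU(2)`: `λ = 4` (junction with the record's unit `uRecOf 4`)

Appended (seat ym-osasm-p2 g7, same sitting): the numeral instances at `N = 2` and `N = 3`.  At `N = 2` the value
`λ = 4` is the one the `UVNonSUNRec` birth skeleton of record (`UVNonSUNRec-birth-K3-safe.lean` fbbac5e5afc05c0a, owner
Δ26) uses in its kernel-checked sanity lemma `uRecOf_four_eq` («at `λ = 4` the generic two-loop unit IS the spine's unit
of record `exp (sizeLog β 1)` up to the constant `(2b₀)^{51/121}`»): together, «datum at `(SU(2), fundamental)` = 4» (here)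
and «unit at 4 = spine's unit» (there) close the `SU(2)` loop of the residual's normalisation by name. -/

/-- `λ(SU(2), fundamental) = 4`: `LieRatio (fundamentalLatticeRep 2) 4` — the value consumed by the skeleton's
`uRecOf_four_eq`. [cite: Sepanski2007, §6.2.2 Exercise 6.19 (1)] -/
theorem lieRatio_fundamental_two : LieRatio (fundamentalLatticeRep 2) 4 := by
  have h := lieRatio_fundamental (le_refl 2)
  norm_num at h
  exact h

/-- At `SU(2)`: `LieRatio (fundamentalLatticeRep 2) λ ↔ λ = 4`. [folklore] -/
theorem lieRatio_fundamental_two_iff (lam : ℝ) : LieRatio (fundamentalLatticeRep 2) lam ↔ lam = 4 :=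
  ⟨fun h => h.unique lieRatio_fundamental_two, fun h => h ▸ lieRatio_fundamental_two⟩

/-- `λ(SU(3), fundamental) = 6` (the physical colour group of the summit's `QCD` conjunct; `C_A/T_F = 3/(1/2)`).
[cite: Sepanski2007, §6.2.2 Exercise 6.19 (1)] -/
theorem lieRatio_fundamental_three : LieRatio (fundamentalLatticeRep 3) 6 := by
  have h := lieRatio_fundamental (show 2 ≤ 3 by norm_num)
  norm_num at h
  exact h

end Summit.QuantumFields.YangMills.Theorems.UVNonSUNRec

end
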